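import Summits.BirchSwinnertonDyer.BirchSwinnertonDyer.Theses.PrintCf2
import Literature.NumberTheory.EllipticCurves.CongruentNumberEvenMonskySelmerExact
import HarnessLib

/-!
# Route `PrintCf2`: the item `HBMonskySelmerEven` CLOSED by name — its Literature constant is a tree THEOREM

Item stmt-BirchSwinnertonDyer-20588 (aside) of route `PrintCf2` is, by name, the Literature constant behind
`Summit.BirchSwinnertonDyer.BirchSwinnertonDyer.Theses.PrintCf2.HBMonskySelmerEven` (Heath-Brown 1994 Appendix (Monsky): the order of the `2`-Selmer group of the congruent number curve, even case). That named fact is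
DISCHARGED in the tree: `Literature.NumberTheory.EllipticCurves.HeathBrown1994.monsky_card_selmerGroup_two_even_holds`
(module `Literature.NumberTheory.EllipticCurves.CongruentNumberEvenMonskySelmerExact`). This file only restates that theorem at the FULLY-QUALIFIED item type, so the
ledger item closes `proved`; nothing is asserted, no hypothesis, no new declaration besides the
alias theorem.

Honest framing: closes ONE cite-only published-input item of a route of `BirchSwinnertonDyer` by
name; no crux; no label or count of any partition moves; BSD is proved for no curve by this file.
Prepared by cell `bsd-eis`, seat `bsd-eis-k5-ty` g14 (literature-prover / typer; BSD-wide scan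
«open item whose Literature constant already has a `_holds`»), for a PROVER of the owning cell to
file. [cite: HeathBrown1994SelmerCongruentII, Appendix (Monsky), typescript p. 41 L20–L36]
-/

set_option autoImplicit false
set_option linter.dupNamespace false

namespace Summit.BirchSwinnertonDyer.BirchSwinnertonDyer.Theorems

/-- **Item `PrintCf2.HBMonskySelmerEven` holds**, by the Literature theorem
`Literature.NumberTheory.EllipticCurves.HeathBrown1994.monsky_card_selmerGroup_two_even_holds`. [cite: HeathBrown1994SelmerCongruentII, Appendix (Monsky), typescript p. 41 L20–L36] -/
theorem printCf2_hBMonskySelmerEven_holds :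
    Summit.BirchSwinnertonDyer.BirchSwinnertonDyer.Theses.PrintCf2.HBMonskySelmerEven :=
  Literature.NumberTheory.EllipticCurves.HeathBrown1994.monsky_card_selmerGroup_two_even_holds

end Summit.BirchSwinnertonDyer.BirchSwinnertonDyer.Theorems
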